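import Summits.BirchSwinnertonDyer.Rank1Residual.X11b.Three.ControlIdentityOdd
import Summits.BirchSwinnertonDyer.Rank1Residual.X11b.Three.TamagawaAtom
import Summits.BirchSwinnertonDyer.Rank1Residual.X11b.BDPRouteNonsingularTorsionDivisible
import HarnessLib

/-!
# X11b at `p = 3` (team `x11b3`, N8/O2): the control identity from published + cited facts ALONE on
# the WHOLE Locus (X11b ∧ (ram) ∧ `p ∤ ∏c`) — the locally-trivial side condition REMOVED
# (sub-target T2-CTL3, part 3; consequences for tightness in `Three/OpenInputTightLocus`)

HONEST FRAMING (cell `b2b-bsdres`, run/shared/lean/b2b/bsd-rank1-residual/, verbatim in every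
file): the goal of the cell is to DELETE the COMBINATION-SHAPED residual classes of the
Birch–Swinnerton-Dyer formula for ALL analytic-rank `≤ 1` elliptic curves over `ℚ` — "full BSD
formula for every rank `≤ 1` curve in class `C`" assembled STRICTLY from published theorems — so
that the rank-`≤ 1` remainder becomes exactly the CONSTRUCTION-SHAPED classes, which are TYPED
(missing-input `Prop`s), NOT attempted. This is not "finishing BSD". Team `x11b3` (coordinator
ruling 2026-08-21T04:04Z) is a RESEARCH ROUTE; no claim beyond the stated class and locus; X11 ∧
`r = 1` at `p = 3` stays CONSTRUCTION-SHAPED / OPEN (RESIDUAL-MAP §I O2); nothing here changes a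
label; THEOREMS ONLY (no definition, no named fact, no `sorry`).

## What this file proves

`Three/ControlIdentityOdd` + `Three/OpenInputTightFacts` (parts 1–2) proved the control identity
(Castella 2018 Thm. 2.3 / JSW 2017 Thm. 3.3.1 on the constructed `X_ac`) and hence THE open input
⟺ `BSD(E,p)` from facts alone on X11b ∧ (ram) ∧ `p ∤ ∏c` ∧ `LocallyTrivialAt W p`, the last
condition asking `E(ℚ_ℓ)[p] = 0` at every bad `ℓ ≠ p` so that the local kernels
`ker(H¹(K_w, E[p^∞]) → H¹(K_{∞,η}, E[p^∞]))`, `w ∈ Σ(N⁺)`, vanish by Galois descent. That condition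
is SUPERFLUOUS: the sibling sub-cell's kernel theorem
`AcSelmer.natCard_localKer_le_pow_padicValNat_localTamagawaNumber` (multr1-p2 gens 13–16,
`BDPRouteNonsingularTorsionDivisible`; Greenberg LNM 1716 Lemma 3.3 on the constructed objects — NO
hypothesis: any number field, any `E`, any `w ∤ p`) bounds `#ker r_w ≤ p^{ord_p c_w(E/K)}`; so
`p ∤ c_w(E/K)` ALONE forces `ker r_w = 0`. At a Heegner field every bad `ℓ` splits, `c_w(E/K) =
c_ℓ(E)` (`localTamagawaNumber_baseChange_eq_of_degree_one`), and `p ∤ ∏_ℓ c_ℓ(E)` gives `p ∤ c_ℓ(E)`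
(`Three.dvd_tamagawaProduct_iff_exists_place`, x11b3-p3). Hence, for EVERY odd `p` (`p = 3` included):

* §1 `AcSelmer.localKer_eq_bot_of_not_dvd_localTamagawaNumber` — `p ∤ c_w(E/K)`, `w ∤ p` ⟹ `ker r_w = ⊥`.
* §2 `controlOnTreeAt_of_two_atoms_of_not_dvd_odd` — (P6) ∧ (L10) ∧ [`p ∤ c_w` on `Σ(N⁺)`] ⟹
  `ControlOnTreeAt`, binders (`p ≠ 2`, `Mult`, `Irr`, `Ram`, (iv)); route R1's local-kernel atom
  (P11) is DISCHARGED wherever `p ∤ c_w` (JSW17 Prop. 3.3.4 Case 1(a): both sides are `1`).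
* §3 **`controlOnTreeAt_heegner_odd_of_facts_of_not_dvd`** — X11b-type pair, (ram), `p ∤ ∏_ℓ c_ℓ(E)`
  ((iv) automatic at `p ≥ 3`), ANY imaginary-quadratic Heegner field, non-torsion Heegner point,
  anticyclotomic `κ`, `γ`, degree-one `𝔭`: `ControlOnTreeAt p κ 𝔭 γ (embAt K p 𝔭) P` from `kolyvagin`
  + the four CITED cohomological facts. NO typed input, NO side condition.
* §4 class level — **`p2ControlOnTree_odd_of_locus`**: the control hypothesis `hC` of
  `Three/OpenInputTight` holds on the WHOLE Locus X11b ∧ (ram) ∧ `p ∤ ∏c` (every odd `p`);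
  `p2ControlOnTreeAt_of_locus`: multr1-p2's `P2ControlOnTreeAt W p` (`p ≥ 5`) likewise.
* §5 for route R1 (multr1-p1): `r1ControlOnTreeAt_of_two_atoms_of_not_dvd_tamagawaProduct` — on
  `p ∤ ∏_ℓ c_ℓ(E)` the two Poitou–Tate atoms give `R1ControlOnTreeAt W p` with NO locally-trivial side
  condition (`r1ControlOnTreeAt_of_two_atoms` had `LocallyTrivialAt W p`); with gen 16/17's discharge
  of both atoms, route R1's control input is facts-only on `R1Population ∧ p ∤ ∏c`.
The companion `Three/OpenInputTightLocus` draws the consequences: THE open input ⟺ `BSD(E,p)` on the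
whole Locus from published + cited facts ALONE (every odd `p`; `p ≥ 5` = multr1-p2's gen-18 tightness
with `hC` discharged; `p = 3` = atom A1, 248 943 class-pairs; `Three.StepLAt W ↔ BSDp W 3` on A1).

What this is NOT: THE open input (IMC≥)∘(BDP) is untouched at every `p` — O2 stays OPEN, N8 NEEDS;
nothing booked; off the Locus ((T2′): `p ∣ ∏c`) the local kernels are NOT claimed trivial; 0 facts.

References: [GreenbergLNM1716] §3 Lemma 3.3 (p. 87), pp. 74–75; [JetchevSkinnerWan2017] §2 (p. 6 L9
"p ≥ 3"), Thm. 3.3.1, Prop. 3.2.1, Lemma 3.3.3, Prop. 3.3.4 (arXiv:1512.06894 pp. 10–13), §7.4.1–7.4.3;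
[Castella2018] Thm. 2.3 (p. 5), Thm. 3.2 (p. 9); [Castella2018Erratum] (2.4); [Skinner2016PacificMC]
Thm. C; [Kolyvagin1990] Thm. A; [MilneADT2006] I 2.8, I 4.10; [Miller2011LMS] Def. 1.1.
-/

noncomputable section

open scoped Classical

open WeierstrassCurve NumberField IsDedekindDomain Field
  Literature.NumberTheory.EllipticCurves Literature.NumberTheory.EllipticCurves.GreenbergSelmer
  Literature.NumberTheory.EllipticCurves.ModularForms Literature.NumberTheory.EllipticCurves.Rank1Residual
  Literature.NumberTheory.EllipticCurves.Rank1Residual.Typed Literature.NumberTheory.EllipticCurves.Wuthrich2014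
  Literature.NumberTheory.GaloisRepresentations Literature.NumberTheory.GaloisCohomology
  Summit.BirchSwinnertonDyer.Rank1Residual.X11b.AcSelmer Summit.BirchSwinnertonDyer.Rank1Residual.X11b.LocBridge

namespace Summit.BirchSwinnertonDyer.Rank1Residual.X11b

/-! ## §1. `p ∤ c_w(E/K)` forces the local kernel at `w ∤ p` to vanish -/

section LocalKer

variable {K : Type} [Field K] [NumberField K] (E : WeierstrassCurve K) [E.IsElliptic] (p : ℕ)
  [Fact p.Prime] (κ : ZpExtension K p)

/-- **`p ∤ c_w(E/K)` ⟹ `ker r_w = 0`** at any place `w ∤ p` of any number field, any `ℤ_p`-extension: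
the sibling's Greenberg-Lemma-3.3 bound `#ker r_w ≤ p^{ord_p c_w(E/K)}` on the constructed objects
(`natCard_localKer_le_pow_padicValNat_localTamagawaNumber`, NO hypothesis) with exponent `0`. In
particular `E(K_w)[p] = 0` is NOT needed. [cite: GreenbergLNM1716, §3 Lemma 3.3 (p. 87) and pp. 74–75]
[cite: JetchevSkinnerWan2017, Prop. 3.3.4 Case 1(a) (arXiv:1512.06894 pp. 12–13)] -/
theorem AcSelmer.localKer_eq_bot_of_not_dvd_localTamagawaNumber {v : HeightOneSpectrum (𝓞 K)}
    (hpv : ((p : ℕ) : 𝓞 K) ∉ v.asIdeal)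
    (hc : ¬ p ∣ (E.baseChange (v.adicCompletion K)).localTamagawaNumber (v.adicCompletionIntegers K)) :
    AcSelmer.localKer κ.kerSubgroup (E.geomPrimaryTorsion p) v = ⊥ := by
  obtain ⟨hfin, hle⟩ := AcSelmer.natCard_localKer_le_pow_padicValNat_localTamagawaNumber E κ hpv
  haveI := hfin
  rw [padicValNat.eq_zero_of_not_dvd hc, pow_zero] at hle
  exact AddSubgroup.eq_bot_of_card_le _ hle

end LocalKer

/-! ## §2. Cas18 Thm. 2.3 from (P6) ∧ (L10) with `p ∤ c_w` on `Σ(N⁺)` — no `E(K_w)[p] = 0` -/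

section TwoAtoms

variable {W : WeierstrassCurve ℚ} [W.IsElliptic] [W.IsGloballyMinimal] {K : Type} [Field K]
  [NumberField K] {p : ℕ} [Fact p.Prime]

/-- **Exact control from (`p ≠ 2`, `Irr`, `Ram`, (iv)) when `p ∤ c_w(E/K)` on `Σ(N⁺)`**:
`#Sel_𝔭(K_∞, E[p^∞])^γ = #Sel_𝔭(K, E[p^∞])` (`K` imaginary quadratic, `κ` anticyclotomic, `𝔭 ∣ p` of
degree one). `Three/ControlIdentityOdd`'s `natCard_…_of_noPTorsion_odd` with the local kernels killed
by §1 instead of by `E(K_w)[p] = 0`. [cite: GreenbergLNM1716, §3 Thm. 1.2, Lemma 3.3 (p. 87)]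
[cite: JetchevSkinnerWan2017, §3.3.4 (arXiv:1512.06894 pp. 13–14)] -/
theorem natCard_endInvariants_empty_eq_natCard_base_of_not_dvd_odd (hp2 : p ≠ 2)
    (hirr : Irr W p) (hram : Ram W p)
    (h4 : ∀ R : (W.baseChange ℚ_[p]).toAffine.Point, p • R = 0 → R = 0)
    (hK : IsImaginaryQuadratic K) {κ : ZpExtension K p} (hκ : κ.IsAnticyclotomic)
    {γ : absoluteGaloisGroup K} (hγ : κ.IsTopGenerator γ)
    (𝔭 : HeightOneSpectrum (𝓞 K)) (h𝔭 : ((p : ℕ) : 𝓞 K) ∈ 𝔭.asIdeal)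
    (he : 𝔭.asIdeal.ramificationIdx (𝓞 ℚ) = 1) (hf : 𝔭.asIdeal.inertiaDeg (𝓞 ℚ) = 1)
    (hloc : ∀ v ∈ nPlusPlaces W K p,
      ¬ p ∣ ((W.baseChange K).baseChange (v.adicCompletion K)).localTamagawaNumber
        (v.adicCompletionIntegers K)) :
    Nat.card (IwasawaDual.endInvariants (conjSelmerAc (W.baseChange K) p κ 𝔭 ∅ γ - 1)) =
      Nat.card (selmerAcBase (W.baseChange K) p 𝔭 ∅) :=
  haveI : (W.baseChange K).IsElliptic := by rw [baseChange]; infer_instance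
  AcSelmer.natCard_endInvariants_empty_eq_of_localKer_eq_bot (nPlusPlaces_finite hK.1)
    (fun v hv ↦ ((mem_nPlusPlaces_iff v).mp hv).1) γ
    (controlMap_bijective_nPlus_of_irr_of_ram hp2 hirr hram h4 hK hκ hγ 𝔭 h𝔭 he hf)
    fun v hv ↦ AcSelmer.localKer_eq_bot_of_not_dvd_localTamagawaNumber (W.baseChange K) p κ
      ((mem_nPlusPlaces_iff v).mp hv).1 (hloc v hv)

/-- **Cas18 Thm. 2.3 from (P6) ∧ (L10) alone on `p ∤ c_w(E/K)`, `w ∈ Σ(N⁺)` — EVERY `p ≠ 2`**, binders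
(`p ≠ 2`, `Mult`, `Irr`, `Ram`, (iv)); the local-kernel atom (P11) of route R1 is a THEOREM here
(both sides of `#ker r_w = c_w^{(p)}` are `1`). `Three/ControlIdentityOdd`'s
`controlOnTreeAt_of_two_atoms_of_noPTorsion_odd` with `E(K_w)[p] = 0` dropped.
[cite: Castella2018, Thm. 2.3 (arXiv:1704.06608 p. 5)] [cite: JetchevSkinnerWan2017, Thm. 3.3.1, Prop. 3.2.1, Lemma 3.3.3, Prop. 3.3.4 (pp. 10–13)] -/
theorem controlOnTreeAt_of_two_atoms_of_not_dvd_odd (hp2 : p ≠ 2) (hmult : Mult W p)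
    (hirr : Irr W p) (hram : Ram W p)
    (h4 : ∀ R : (W.baseChange ℚ_[p]).toAffine.Point, p • R = 0 → R = 0)
    (hK : IsImaginaryQuadratic K) (hsplit : SplitsIn K p) {κ : ZpExtension K p}
    (hκ : κ.IsAnticyclotomic) (γ : absoluteGaloisGroup K) [hγ : Fact (κ.IsTopGenerator γ)]
    (𝔭 : HeightOneSpectrum (𝓞 K)) (h𝔭 : ((p : ℕ) : 𝓞 K) ∈ 𝔭.asIdeal)
    (he : 𝔭.asIdeal.ramificationIdx (𝓞 ℚ) = 1) (hf : 𝔭.asIdeal.inertiaDeg (𝓞 ℚ) = 1)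
    (ι : K →+* ℚ_[p]) (P : (W.baseChange K).toAffine.Point)
    (h6 : BaseSelmerCountAt p 𝔭 ι P) (h10 : CoinvariantsTrivialAt (W.baseChange K) p κ 𝔭 γ)
    (hloc : ∀ v ∈ nPlusPlaces W K p,
      ¬ p ∣ ((W.baseChange K).baseChange (v.adicCompletion K)).localTamagawaNumber
        (v.adicCompletionIntegers K)) :
    ControlOnTreeAt p κ 𝔭 γ ι P := by
  have hp : p.Prime := Fact.out
  rw [controlOnTreeAt_iff_card p κ 𝔭 γ ι P]
  obtain ⟨a, ⟨_, hcardK⟩, ha⟩ := h6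
  have hpN : p ∣ W.conductorNorm ℤ := dvd_conductorNorm_of_mult hmult
  have hcard := natCard_endInvariants_empty_eq_natCard_base_of_not_dvd_odd hp2 hirr hram h4 hK hκ
    hγ.out 𝔭 h𝔭 he hf hloc
  have hcoinv := natCard_endCoinvariants_eq_one_of_surjective _ h10
  have hsum : (∑ v ∈ (nPlusPlaces_finite (W := W) (p := p) hK.1).toFinset, padicValNat p
      (((W.baseChange K).baseChange (v.adicCompletion K)).localTamagawaNumber
        (v.adicCompletionIntegers K))) = 0 := by
    refine Finset.sum_eq_zero fun v hv ↦ ?_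
    exact padicValNat.eq_zero_of_not_dvd
      (hloc v ((nPlusPlaces_finite (W := W) (p := p) hK.1).mem_toFinset.mp hv))
  refine ⟨a, ⟨?_, ?_⟩, ?_⟩
  · refine Nat.finite_of_card_ne_zero ?_
    rw [hcard, hcardK]
    exact pow_ne_zero _ hp.ne_zero
  · rw [hcard, hcardK, hcoinv, mul_one]
  · rw [ha, padicValNat_tamagawaProductSplit_eq_above_add_sum W p hK.1 hsplit hpN, hsum]
    push_cast
    ring

end TwoAtoms

/-! ## §3. The control identity at a Heegner datum on the Locus, from facts — every `p ≠ 2` -/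

section HeegnerDatum

variable (W : WeierstrassCurve ℚ) [W.IsElliptic] [W.IsGloballyMinimal] (p : ℕ) [Fact p.Prime]

omit [W.IsGloballyMinimal] in
/-- At a place `w ∈ Σ(N⁺)` (above a bad `ℓ ≠ p`, `e = f = 1`), `p ∤ ∏_ℓ c_ℓ(E)` gives `p ∤ c_w(E/K)`:
`c_w(E/K) = c_ℓ(E)` (`localTamagawaNumber_baseChange_eq_of_degree_one`) and `c_ℓ(E) ∣ ∏ c`
(`Three.dvd_tamagawaProduct_iff_exists_place`). [cite: Castella2018, §5 (arXiv:1704.06608 p. 12), "`c_w = c_ℓ` at split `ℓ`"] -/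
theorem not_dvd_localTamagawaNumber_nPlusPlaces_of_not_dvd_tamagawaProduct
    (htam : ¬ p ∣ W.tamagawaProduct) {K : Type} [Field K] [NumberField K]
    {v : HeightOneSpectrum (𝓞 K)} (hv : v ∈ nPlusPlaces W K p) :
    ¬ p ∣ ((W.baseChange K).baseChange (v.adicCompletion K)).localTamagawaNumber
        (v.adicCompletionIntegers K) := by
  obtain ⟨-, -, he, hf⟩ := (mem_nPlusPlaces_iff v).mp hv
  rw [localTamagawaNumber_baseChange_eq_of_degree_one W v he hf]
  intro h
  exact htam ((Three.dvd_tamagawaProduct_iff_exists_place W Fact.out).mpr ⟨v.under (𝓞 ℚ), h⟩)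

/-- **THE CONTROL IDENTITY ON TREE OBJECTS AT A HEEGNER DATUM ON THE LOCUS, EVERY `p ≠ 2` (`p = 3`
INCLUDED), FROM FACTS — no side condition.** For a globally minimal elliptic `W/ℚ` and a prime
`p ≠ 2` of multiplicative reduction with `E[p]` irreducible, a (ram) prime and `p ∤ ∏_ℓ c_ℓ(E)`; for `K`
imaginary quadratic with the Heegner hypothesis for `N_E`, a Heegner point `P ∈ E(K)` of level `N_E`
of infinite order, every anticyclotomic `κ`, topological generator `γ`, degree-one `𝔭 ∋ p`:
`ControlOnTreeAt p κ 𝔭 γ (embAt K p 𝔭) P` (Cas18 Thm. 2.3 / JSW17 Thm. 3.3.1 as an IDENTITY on the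
constructed `X_ac(E[p^∞])`, torsion clause included). Inputs: Kolyvagin (`kolyvagin`: `rank E(K) = 1`,
`Ш(E/K)` finite) and the four CITED cohomological facts; (iv) by `p ∤ ∏c`
(`LocalTorsion.localTorsion_eq_zero_of_not_dvd_tamagawaProduct`, `p ≥ 3`), (P6) by
`baseSelmerCountAt_of_rankOne`, (L10) by `coinvariantsTrivialAt_of_noPTorsion`, local kernels by §1.
[cite: Castella2018, Thm. 2.3 (arXiv:1704.06608 p. 5)] [cite: JetchevSkinnerWan2017, Thm. 3.3.1, Prop. 3.2.1, Lemma 3.3.3, Prop. 3.3.4 (pp. 10–13)]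
[cite: GreenbergLNM1716, §3 Lemma 3.3 (p. 87)] [cite: Kolyvagin1990, Thm. A] [cite: MilneADT2006, Ch. I, Thm. 4.10 and Thm. 2.8] -/
theorem controlOnTreeAt_heegner_odd_of_facts_of_not_dvd
    (hKo : ∀ (N : ℕ) [NeZero N] (W : WeierstrassCurve ℚ) (K : Type) [Field K] [NumberField K],
      kolyvagin N W K)
    (hPT : ∀ (K : Type) [Field K] [NumberField K], poitouTate_selmerStructure_duality K)
    (hPT2 : ∀ (K : Type) [Field K] [NumberField K], poitouTate_sha_tateDual K)
    (hEP : ∀ (K : Type) [Field K] [NumberField K] (v : HeightOneSpectrum (𝓞 K)),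
      localEulerPoincareCharacteristic (v.adicCompletion K))
    (hcd : fieldCdLE_two_of_numberField)
    (hp2 : p ≠ 2) (hmult : Mult W p) (hirr : Irr W p) (hram : Ram W p)
    (htam : ¬ p ∣ W.tamagawaProduct)
    {N : ℕ} [NeZero N] {K : Type} [Field K] [NumberField K]
    (Dt : ModularParametrizationData W N) (Hg : HeegnerDatum N (NumberField.discr K)) (ι : K →+* ℂ)
    {P : (W.baseChange K).toAffine.Point}
    (hN : W.conductorNorm ℤ = N) (hK : IsImaginaryQuadratic K) (hHN : SatisfiesHeegnerHypothesis N K)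
    (hP : WeierstrassCurve.Affine.Point.map ι.toRatAlgHom P = heegnerPointComplex Dt Hg)
    (hPinf : ¬ IsOfFinAddOrder P)
    {κ : ZpExtension K p} (hκ : κ.IsAnticyclotomic) (γ : Field.absoluteGaloisGroup K)
    [Fact (κ.IsTopGenerator γ)]
    (𝔭 : HeightOneSpectrum (𝓞 K)) (h𝔭 : ((p : ℕ) : 𝓞 K) ∈ 𝔭.asIdeal)
    (he : 𝔭.asIdeal.ramificationIdx (𝓞 ℚ) = 1) (hf : 𝔭.asIdeal.inertiaDeg (𝓞 ℚ) = 1) :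
    ControlOnTreeAt p κ 𝔭 γ (embAt K p 𝔭 h𝔭 he hf) P := by
  have hp3 : 3 ≤ p := by
    have := (Fact.out : p.Prime).two_le
    omega
  have h4 := LocalTorsion.localTorsion_eq_zero_of_not_dvd_tamagawaProduct W p hp3 hmult htam
  have hpN : p ∣ W.conductorNorm ℤ := dvd_conductorNorm_of_mult hmult
  have hsplit : SplitsIn K p := hHN p Fact.out (hN ▸ hpN)
  obtain ⟨hrank, hSha⟩ := hKo N W K hK hHN ⟨Dt, Hg, ι, hP⟩ hPinf
  have hfin : ∀ v : HeightOneSpectrum (𝓞 K), ((p : ℕ) : 𝓞 K) ∈ v.asIdeal →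
      Finite (selmerAcBase (W.baseChange K) p v ∅) := fun v hv ↦ by
    obtain ⟨a, ⟨hfinv, -⟩, -⟩ := baseSelmerCountAt_of_rankOne W p K (hPT K) (hEP K) hmult hirr hK
      hsplit h4 hrank hSha P hPinf v hv (degreeOne_of_splitsIn hK.1 hsplit hv).1
      (degreeOne_of_splitsIn hK.1 hsplit hv).2
    exact hfinv
  have h6 : BaseSelmerCountAt p 𝔭 (embAt K p 𝔭 h𝔭 he hf) P :=
    baseSelmerCountAt_of_rankOne W p K (hPT K) (hEP K) hmult hirr hK hsplit h4 hrank hSha P hPinf 𝔭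
      h𝔭 he hf
  have h10 : CoinvariantsTrivialAt (W.baseChange K) p κ 𝔭 γ :=
    coinvariantsTrivialAt_of_noPTorsion W p h4 (hPT K) (hPT2 K) (hEP K) hcd hK hsplit κ
      (Fact.out : κ.IsTopGenerator γ) h𝔭 he hf hfin
  exact controlOnTreeAt_of_two_atoms_of_not_dvd_odd hp2 hmult hirr hram h4 hK hsplit hκ γ 𝔭 h𝔭 he hf
    (embAt K p 𝔭 h𝔭 he hf) P h6 h10 fun v hv ↦
      not_dvd_localTamagawaNumber_nPlusPlaces_of_not_dvd_tamagawaProduct W p htam hv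

/-! ## §4. Class level on the WHOLE Locus: route p2's control hypothesis, every odd `p` -/

/-- **Route p2's control hypothesis `hC` (the ∀-data body of `P2ControlOnTreeAt W p` WITHOUT `5 ≤ p`,
verbatim as in `Three/OpenInputTight`) holds on the WHOLE Locus X11b ∧ (ram) ∧ `p ∤ ∏_ℓ c_ℓ(E)`,
EVERY ODD `p`**, modulo Kolyvagin and the four cited cohomological facts — the locally-trivial side
condition of `p2ControlOnTree_odd_of_locallyTrivial` REMOVED. CONDITIONAL on the named/cited facts
only; nothing booked; O2 / N8 unchanged. [cite: Castella2018, Thm. 2.3 (arXiv:1704.06608 p. 5)]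
[cite: JetchevSkinnerWan2017, Thm. 3.3.1, Prop. 3.3.4 (arXiv:1512.06894 pp. 11–13)] [cite: GreenbergLNM1716, §3 Lemma 3.3 (p. 87)] -/
theorem p2ControlOnTree_odd_of_locus
    (hKo : ∀ (N : ℕ) [NeZero N] (W : WeierstrassCurve ℚ) (K : Type) [Field K] [NumberField K],
      kolyvagin N W K)
    (hPT : ∀ (K : Type) [Field K] [NumberField K], poitouTate_selmerStructure_duality K)
    (hPT2 : ∀ (K : Type) [Field K] [NumberField K], poitouTate_sha_tateDual K)
    (hEP : ∀ (K : Type) [Field K] [NumberField K] (v : HeightOneSpectrum (𝓞 K)),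
      localEulerPoincareCharacteristic (v.adicCompletion K))
    (hcd : fieldCdLE_two_of_numberField)
    (hX : ClassX11b W p) (hram : Ram W p) (htam : ¬ p ∣ W.tamagawaProduct) :
    ∀ (N : ℕ) [NeZero N] (K : Type) [Field K] [NumberField K]
      (Dt : ModularParametrizationData W N) (H : HeegnerDatum N (NumberField.discr K)) (ι : K →+* ℂ)
      (P : (W.baseChange K).toAffine.Point),
      ClassX11b W p → Surj W p → W.conductorNorm ℤ = N → IsImaginaryQuadratic K →
      Odd (NumberField.discr K) → ¬ (p : ℤ) ∣ NumberField.discr K → ¬ p ∣ Units.torsionOrder K →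
      SatisfiesHeegnerHypothesis N K →
      (W.quadraticTwist (NumberField.discr K : ℚ)).entireLFunction 1 ≠ 0 →
      WeierstrassCurve.Affine.Point.map ι.toRatAlgHom P = heegnerPointComplex Dt H →
      ¬ (p : ℤ) ∣ Dt.c → ¬ IsOfFinAddOrder P →
      ∀ (κ : ZpExtension K p), κ.IsAnticyclotomic →
        ∀ (γ : Field.absoluteGaloisGroup K) [Fact (κ.IsTopGenerator γ)]
          (𝔭 : HeightOneSpectrum (𝓞 K)) (h𝔭 : ((p : ℕ) : 𝓞 K) ∈ 𝔭.asIdeal)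
          (he : 𝔭.asIdeal.ramificationIdx (𝓞 ℚ) = 1) (hf : 𝔭.asIdeal.inertiaDeg (𝓞 ℚ) = 1),
          ControlOnTreeAt p κ 𝔭 γ (embAt K p 𝔭 h𝔭 he hf) P := by
  intro N _ K _ _ Dt H ι P _ _ hN hK _ _ _ hHN _ hP _ hPinf κ hκ γ _ 𝔭 h𝔭 he hf
  obtain ⟨-, hp2, hmult, hirr⟩ := hX
  exact controlOnTreeAt_heegner_odd_of_facts_of_not_dvd W p hKo hPT hPT2 hEP hcd hp2 hmult hirr hram
    htam Dt H ι hN hK hHN hP hPinf hκ γ 𝔭 h𝔭 he hf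

/-- **multr1-p2's `P2ControlOnTreeAt W p` (`p ≥ 5` among its antecedents) is a THEOREM on the whole
Locus**, modulo Kolyvagin and the four cited cohomological facts: the hypothesis `hC` of the gen-18
tightness `P2.openInputOnTreeAt_iff_bsdp_of_locus` is discharged on its own Locus (class-wide
2 093 111 X11b-shape pairs at `p ≥ 5`). CONDITIONAL on the named/cited facts; nothing booked.
[cite: Castella2018, Thm. 2.3 (arXiv:1704.06608 p. 5)] [cite: GreenbergLNM1716, §3 Lemma 3.3 (p. 87)] -/
theorem p2ControlOnTreeAt_of_locus
    (hKo : ∀ (N : ℕ) [NeZero N] (W : WeierstrassCurve ℚ) (K : Type) [Field K] [NumberField K],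
      kolyvagin N W K)
    (hPT : ∀ (K : Type) [Field K] [NumberField K], poitouTate_selmerStructure_duality K)
    (hPT2 : ∀ (K : Type) [Field K] [NumberField K], poitouTate_sha_tateDual K)
    (hEP : ∀ (K : Type) [Field K] [NumberField K] (v : HeightOneSpectrum (𝓞 K)),
      localEulerPoincareCharacteristic (v.adicCompletion K))
    (hcd : fieldCdLE_two_of_numberField)
    (hX : ClassX11b W p) (hram : Ram W p) (htam : ¬ p ∣ W.tamagawaProduct) :
    P2ControlOnTreeAt W p := by
  intro N _ K _ _ Dt H ι P hX' _ hs hN hK hodd hpd hμ hHN hLt hP hc hPinf κ hκ γ _ 𝔭 h𝔭 he hf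
  exact p2ControlOnTree_odd_of_locus W p hKo hPT hPT2 hEP hcd hX hram htam N K Dt H ι P hX' hs hN hK
    hodd hpd hμ hHN hLt hP hc hPinf κ hκ γ 𝔭 h𝔭 he hf

/-! ## §5. For route R1 (multr1-p1): (CTL) from the two Poitou–Tate atoms on `p ∤ ∏c`, no side condition -/

/-- **Route R1, class level: `p ∤ ∏_ℓ c_ℓ(E) → R1TwoAtomsAt W p → R1ControlOnTreeAt W p`** — the
sibling's `r1ControlOnTreeAt_of_two_atoms` with its side condition `LocallyTrivialAt W p` REPLACED by
`p ∤ ∏c` (the local kernels at `Σ(N⁺)` vanish by §1, not by `E(K_w)[p] = 0`); the erratum-field data,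
`ErratumHypotheses` and `Cas20Standing` binders are route R1's own and untouched. With
`r1TwoAtomsAt_of_baseSelmerCount` + `r1BaseSelmerCountAt_of_facts` (gens 16–17) route R1's control
input is facts-only on `R1Population ∧ p ∤ ∏c`. CONDITIONAL; nothing booked.
[cite: Castella2018, Thm. 2.3 (arXiv:1704.06608 p. 5)] [cite: JetchevSkinnerWan2017, Thm. 3.3.1, Prop. 3.2.1, Lemma 3.3.3, Prop. 3.3.4 (pp. 10–13)]
[cite: GreenbergLNM1716, §3 Lemma 3.3 (p. 87)] -/
theorem r1ControlOnTreeAt_of_two_atoms_of_not_dvd_tamagawaProduct (htam : ¬ p ∣ W.tamagawaProduct)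
    (hTA : R1TwoAtomsAt W p) : R1ControlOnTreeAt W p := by
  intro _ q _ K _ _ Dt H ι P hE hr hqp hmq hns hvq hK hCas hP hc hinf κ hκ γ _ 𝔭 h𝔭 he hf
  have hpN : p ∣ W.conductorNorm ℤ := dvd_conductorNorm_of_mult hE.2.1
  have hsplit : SplitsIn K p := hK.2.2.1 p (Fact.out : p.Prime) hpN (Ne.symm hqp)
  obtain ⟨h6, h10⟩ := hTA q K Dt H ι P hE hr hqp hmq hns hvq hK hCas hP hc hinf κ hκ γ 𝔭 h𝔭 he hf
  exact controlOnTreeAt_of_two_atoms_of_not_dvd_odd hE.two_ne hE.2.1 hE.2.2.1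
    (X11.ram_of_aprimeLocusAt hE.2.2.2) hE.2.2.2.2 hK.1 hsplit hκ γ 𝔭 h𝔭 he hf
    (embAt K p 𝔭 h𝔭 he hf) P h6 h10 fun v hv ↦
      not_dvd_localTamagawaNumber_nPlusPlaces_of_not_dvd_tamagawaProduct W p htam hv

end HeegnerDatum

end Summit.BirchSwinnertonDyer.Rank1Residual.X11b

end
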